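import Summits.ABC.IUTFork.Cor312ProvenanceDHWitness
import Summits.ABC.IUTFork.Cor312PilotIdelesCapstone
import Literature.IUT.LogVolume.Corollary22QParamBaseChange
import Literature.IUT.LogVolume.GenuineSupportPrimesBound
import HarnessLib

/-!
# [IUTchIII] Cor. 3.12 provenance — the `K`-LEVEL Dupuy–Hilado pilot datum of a collection of initial Θ-data (base change
# of abc-iut-c312-3's `PilotData` along a finite extension), its q-number, and the EXISTENCE of realising ideles over `K`
# (repair R1 of FINDING C-cert-3-F1, C-lead ruling C-R16 (b))

DEFINITION + proof file of the abc-iut cell (seat abc-iut-C-cert-3, branch C INTAKE; C-lead ruling C-R16 2026-08-26T08:31:30Z «REPAIR R1 —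
GO C-cert-3 … a NEW module, e.g. `Summits/ABC/IUTFork/Cor312ProvK.lean`»; abc-iut-c312-8's first refusal lapsed silent 08:46:30Z). TAKES NO
SIDE on [IUTchIII] Cor. 3.12. Nothing in the frozen closure files is edited; abc-iut-c312-8's `F`-level provenance
(`Cor312ProvenanceDH*`: `IsPilotDataOf D (X : PilotData F)`, `pilotDataOfF D`) is imported and base-changed, not restated.

WHY (FINDING C-cert-3-F1, `Conditional/AbcOfSGenuineSideVacuity.lean` p432420, adopted C-R16): abc-iut-c312-3's Dupuy–Hilado idele binders
REALISING the pilot divisors live in the completions of the field of the pilot data; realising forces `2l ∣ ord_v(q_v)` there, which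
[IUTchI] Def. 3.1 (c) (`l ∤ ord_v(q_v)`) forbids over the field `F` of the initial Θ-datum. Print computes over `K = F(E_F[l])`, where
`q̲_v := q_v^{1/2l} ∈ K_v̲` ([IUTchI] Ex. 3.2 (iv)). THIS MODULE supplies the `K`-level (indeed: any finite extension `L ⊇ F`) pilot datum:

* §1 `primesOverS L S` — the primes of `𝓞_L` over a finite set `S` of primes of `𝓞_F`; `mem_primesOverS_iff : w ∈ primesOverS L S ↔ finBelow F L w ∈ S`.
* §2 **`PilotData.baseChange L X : PilotData L`** of `X : PilotData F` — `j_E ↦ j_E ∈ L`, `S ↦` the primes over `S`, `l` unchanged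
  ([GenEll] Rem. 3.3.1 / [IUTchIV] Cor. 2.2 proof (P2): «the orders of the q-parameters get multiplied by ramification indices»):
  `ordq_baseChange : ord_w(q) = e(w|v)·ord_v(q_v)` (the tree's `ord_algebraMap`), `ofFinDivisor_qPilot_baseChange : P_q(X_L) = P_q(X)|_L`
  ([IUTchIV] Def. 1.9 (i) pull-back), hence **`ndeg_qPilot_baseChange : deĝ_L(P_q(X_L)) = deĝ_F(P_q(X))`** (`ndeg_pullback` — [IUTchIV]
  Thm. 1.10 p. 23 «the various `log(q_{(−)})`'s are independent of the choice of `F□`»).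
* §3 **`pilotDataOfK D L := (pilotDataOfF D).baseChange L`** and **`absLogq_eq_ndeg_qPilot_pilotDataOfK : absLogq D = deĝ_L(P_q)`** —
  abc-iut-c312-8's `|log(q)| = deĝ_F(P_q)` (`absLogq_eq_ndeg_qPilot_pilotDataOfF`, PROVED) transported to `L`; the HYPOTHESIS STRUCTURE
  `IsPilotDataOfK D L X` (`K`-level twin of `IsPilotDataOf`: same `l`, `S` = primes over `𝕍(F)^bad`, `ord_w(q) = e(w|v)·qParamOrd E v`),
  inhabited by `pilotDataOfK` (`isPilotDataOfK_pilotDataOfK`).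
* §4 the divisibility «`2l ∣ ord_w(q)` at every `w ∈ S_L`» as a NAMED predicate `TwoMulLDvdOrdq X` (a `def … : Prop`; [IUTchI] Ex. 3.2
  (iv): the valuation of `q̲ = q^{1/2l}` is attained), with: UNDER it abc-iut-c312-3's realising q-ideles and Θ-ideles EXIST at `X` and are
  units off `S` (`exists_realising_qIdeles_of_twoMulLDvdOrdq`, `…thetaIdeles…`) — the side-condition WITNESS wanted by C-R16 (b);
* (in the proof-only companion `Conditional/AbcOfSGenuineK.lean`, not here:) **`twoMulLDvdOrdq_pilotDataOfK : TwoMulLDvdOrdq (pilotDataOfK D K)`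
  — PROVED for the Θ-datum's OWN `K = F(E_F[l])`** from the tree's typed Def. 3.1 (b)(c) consequences
  (`InitialThetaData.two_mul_dvd_ordMinimalDiscriminant_baseChange`: `2l ∣ ord_w(Δ_min(E_K))` at every prime of `K` over `𝕍(F)^bad` —
  [IUTchI] Ex. 3.2 (iv) as a THEOREM of the typed data — with Tate's `ord_w(q) = −ord_w(j_E)`); so NO hypothesis `hK` is needed and at the
  `K`-level pilot datum of EVERY initial Θ-datum the realising ideles EXIST — the exact negation of the `F`-level situation of FINDING
  C-cert-3-F1 (`SideVacuity.not_realising_qIdeles_of_isPilotDataOf`). This module keeps only the definitions and their base-change API.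

HONEST FRAMING: bookkeeping about OUR typing (which field the Dupuy–Hilado ideles live in); classical algebraic number theory throughout;
nothing here bears on the truth of [IUTchIII] Cor. 3.12 or of abc; no side taken on any author. `TwoMulLDvdOrdq` is a predicate with a print
locator, PROVED at `pilotDataOfK D K` in the companion and never asserted. typed ≠ proved; instantiated ≠ endorsed.
[cite: Mochizuki2012, IUTchI Def. 3.1 (c) p. 61, Ex. 3.2 (iv) p. 71; IUTchIV Def. 1.9 (i) p. 22, Thm. 1.10 p. 23, Cor. 2.2 (P2) p. 45]
[cite: DupuyHilado2025, §3.3, §3.4] [cite: NeukirchANT1999, Ch. I (8.2), Ch. II Prop. (6.8)]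
-/

noncomputable section

open Set Function NumberField IsDedekindDomain

namespace Summit.ABC.IUTFork.Cor312Prov

open Literature.IUT.LogVolume Literature.IUT.HodgeTheaters Thm311.Real
open scoped Classical

universe u

/-! ## §1. The primes of `𝓞_L` over a finite set of primes of `𝓞_F` -/

section PrimesOver

variable {F : Type} [Field F] [NumberField F] (L : Type) [Field L] [NumberField L] [Algebra F L]

/-- The (finite) set of primes of `𝓞_L` lying over a finite set `S` of primes of `𝓞_F` (union of the fibres `{v}|_L`,
[IUTchIV] Def. 1.9 (ii); Mathlib `primesOverFinset`). [cite: Mochizuki2012, IUTchIV Def. 1.9 (ii) p. 22] -/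
def primesOverS (S : Finset (HeightOneSpectrum (𝓞 F))) : Finset (HeightOneSpectrum (𝓞 L)) :=
  S.biUnion fun v => (IsDedekindDomain.primesOverFinset v.asIdeal (𝓞 L)).preimage HeightOneSpectrum.asIdeal
    (fun _ _ _ _ h => HeightOneSpectrum.ext h)

variable {L}

/-- `w` lies over `S` iff the prime of `F` under `w` lies in `S`. [cite: Mochizuki2012, IUTchIV Def. 1.9 (ii) p. 22] -/
theorem mem_primesOverS_iff (S : Finset (HeightOneSpectrum (𝓞 F))) (w : HeightOneSpectrum (𝓞 L)) :
    w ∈ primesOverS L S ↔ finBelow F L w ∈ S := by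
  unfold primesOverS
  rw [Finset.mem_biUnion]
  constructor
  · rintro ⟨v, hv, hw⟩
    rwa [finBelow_eq_of_mem hw]
  · intro h
    refine ⟨finBelow F L w, h, ?_⟩
    rw [Finset.mem_preimage, IsDedekindDomain.mem_primesOverFinset_iff (finBelow F L w).ne_bot]
    exact ⟨w.isPrime, liesOver_finBelow F L w⟩

omit [NumberField F] [NumberField L] in
/-- Over every prime of `𝓞_F` there is a prime of `𝓞_L` (integral extension of Dedekind domains; Mathlib `Ideal.nonempty_primesOver`).
[cite: NeukirchANT1999, Ch. I (8.2)] -/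
theorem exists_finBelow_eq (v : HeightOneSpectrum (𝓞 F)) : ∃ w : HeightOneSpectrum (𝓞 L), finBelow F L w = v := by
  haveI : v.asIdeal.IsPrime := v.isPrime
  obtain ⟨⟨P, hPprime, hPover⟩⟩ := Ideal.nonempty_primesOver (S := 𝓞 L) v.asIdeal
  haveI := hPover
  have hPne : P ≠ ⊥ := Ideal.ne_bot_of_liesOver_of_ne_bot v.ne_bot P
  refine ⟨⟨P, hPprime, hPne⟩, ?_⟩
  exact HeightOneSpectrum.ext hPover.over.symm

/-- If `S ≠ ∅` then `primesOverS L S ≠ ∅`. [cite: NeukirchANT1999, Ch. I (8.2)] -/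
theorem primesOverS_nonempty {S : Finset (HeightOneSpectrum (𝓞 F))} (hS : S.Nonempty) : (primesOverS L S).Nonempty := by
  obtain ⟨v, hv⟩ := hS
  obtain ⟨w, hw⟩ := exists_finBelow_eq (L := L) v
  exact ⟨w, (mem_primesOverS_iff S w).mpr (hw ▸ hv)⟩

end PrimesOver

/-! ## §2. Base change of Dupuy–Hilado pilot data along a finite extension `L ⊇ F` -/

section BaseChange

variable {F : Type} [Field F] [NumberField F] (L : Type) [Field L] [NumberField L] [Algebra F L] (X : PilotData F)

/-- **Base change of Dupuy–Hilado pilot data** `(F, j_E, S, l) ↦ (L, j_E, S|_L, l)`: the same `j`-invariant viewed in `L`, the primes of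
`L` over the bad set, the same `l` ([GenEll] Rem. 3.3.1; [IUTchIV] Cor. 2.2 proof (P2): over an extension the bad places are the places
over the bad places and «the orders of the q-parameters get multiplied by ramification indices», so `ord_w(j_E) < 0` persists).
[cite: DupuyHilado2025, §3.3] [cite: Mochizuki2012, IUTchIV Cor. 2.2 (P2) p. 45] -/
def _root_.Literature.IUT.LogVolume.PilotData.baseChange : PilotData L where
  jE := algebraMap F L X.jE
  S := primesOverS L X.S
  S_nonempty := primesOverS_nonempty X.S_nonempty
  ord_jE_neg := by
    intro w hw
    rw [Cor22.ord_algebraMap_neg_iff]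
    exact X.ord_jE_neg _ ((mem_primesOverS_iff X.S w).mp hw)
  l := X.l
  l_prime := X.l_prime
  five_le_l := X.five_le_l

/-- Its `l` is `X`'s. [cite: DupuyHilado2025, §3.3] -/
@[simp] theorem baseChange_l : (X.baseChange L).l = X.l := rfl

/-- Its `j`-invariant is `X`'s viewed in `L`. [cite: DupuyHilado2025, §3.3] -/
@[simp] theorem baseChange_jE : (X.baseChange L).jE = algebraMap F L X.jE := rfl

/-- Its bad set is the set of primes over `X`'s. [cite: DupuyHilado2025, §3.3] -/
theorem mem_baseChange_S_iff (w : HeightOneSpectrum (𝓞 L)) : w ∈ (X.baseChange L).S ↔ finBelow F L w ∈ X.S :=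
  mem_primesOverS_iff X.S w

/-- **`ord_w(q) = e(w|v)·ord_v(q_v)`** for the base-changed pilot data (`ord_w(j_E) = e(w|v)·ord_v(j_E)`, the tree's `ord_algebraMap`).
[cite: Mochizuki2012, IUTchIV Cor. 2.2 (P2) p. 45] [cite: DupuyHilado2025, §2.4.2] -/
theorem ordq_baseChange (w : HeightOneSpectrum (𝓞 L)) :
    (X.baseChange L).ordq w = ((finBelow F L w).asIdeal.ramificationIdx' w.asIdeal : ℤ) * X.ordq (finBelow F L w) := by
  unfold PilotData.ordq
  rw [baseChange_jE, Cor22.ord_algebraMap_eq]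
  ring

/-- Coefficients of a Dupuy–Hilado q-pilot divisor: `ord_v(q_v)/(2l)` on `S`, `0` off `S` (bookkeeping form of abc-iut-c312-3's
`qPilot_apply_of_mem` / `_of_not_mem`). [cite: DupuyHilado2025, §3.3] -/
theorem qPilot_apply_ite {M : Type} [Field M] [NumberField M] (Y : PilotData M) (v : HeightOneSpectrum (𝓞 M)) :
    Y.qPilot v = if v ∈ Y.S then (Y.ordq v : ℝ) / (2 * Y.l) else 0 := by
  split_ifs with hv
  · exact Y.qPilot_apply_of_mem hv
  · exact Y.qPilot_apply_of_not_mem hv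

/-- **`P_q(X_L) = P_q(X)|_L`** as `ℝ`-arithmetic divisors ([IUTchIV] Def. 1.9 (i): the pull-back `𝔞|_L = Σ_w e(w|v)·c_{v(w)}·w`;
coefficientwise `e(w|v)·ord_v(q_v)/(2l) = ord_w(q)/(2l)`; pattern of the tree's `Cor22.ofFinDivisor_qDivisor_of_algebraMap`).
[cite: Mochizuki2012, IUTchIV Def. 1.9 (i) p. 22] -/
theorem ofFinDivisor_qPilot_baseChange :
    ADivisor.ofFinDivisor L (X.baseChange L).qPilot = (ADivisor.ofFinDivisor F X.qPilot).pullback F L := by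
  ext w
  rcases w with w | w
  · rw [ADivisor.ofFinDivisor_apply_inl, ADivisor.pullback_apply]
    change (0 : ℝ) = _ * ADivisor.ofFinDivisor F X.qPilot (Sum.inl (w.comap (algebraMap F L)))
    rw [ADivisor.ofFinDivisor_apply_inl, mul_zero]
  · rw [ADivisor.pullback_apply]
    change ADivisor.ofFinDivisor L (X.baseChange L).qPilot (Sum.inr w) =
      _ * ADivisor.ofFinDivisor F X.qPilot (Sum.inr (finBelow F L w))
    rw [ADivisor.ofFinDivisor_apply_inr, ADivisor.ofFinDivisor_apply_inr, qPilot_apply_ite, qPilot_apply_ite]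
    have he : (pullbackWeight F L (Sum.inr w) : ℝ) = ((finBelow F L w).asIdeal.ramificationIdx' w.asIdeal : ℝ) := rfl
    by_cases hw : finBelow F L w ∈ X.S
    · rw [if_pos ((mem_baseChange_S_iff L X w).mpr hw), if_pos hw, he, ordq_baseChange, baseChange_l]
      push_cast
      ring
    · rw [if_neg (fun h => hw ((mem_baseChange_S_iff L X w).mp h)), if_neg hw, mul_zero]

/-- **`deĝ_L(P_q(X_L)) = deĝ_F(P_q(X))`**: the degree-normalised q-number of Dupuy–Hilado pilot data is invariant under base change
([IUTchIV] Thm. 1.10 p. 23 «the various `log(q_{(−)})`'s are independent of the choice of `F□`»; `ndeg_pullback`).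
[cite: Mochizuki2012, IUTchIV Thm. 1.10 p. 23] -/
theorem ndeg_qPilot_baseChange : FinDivisor.ndeg L (X.baseChange L).qPilot = FinDivisor.ndeg F X.qPilot := by
  rw [← ndeg_ofFinDivisor, ← ndeg_ofFinDivisor, ofFinDivisor_qPilot_baseChange, ndeg_pullback]

end BaseChange

/-! ## §3. The `K`-level pilot datum OF a collection of initial Θ-data, its q-number, the provenance structure -/

section Genuine

variable {F K Fbar : Type} [Field F] [NumberField F] [Field K] [NumberField K] [Algebra F K] [Field Fbar]
  [Algebra F Fbar] [Algebra K Fbar] {E : WeierstrassCurve F} [E.IsElliptic] {l : ℕ} {Pb : BadPlacePredicates K}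
  (D : InitialThetaData F K Fbar E l Pb) (L : Type) [Field L] [NumberField L] [Algebra F L]

/-- **The Dupuy–Hilado pilot datum OF `D` over a finite extension `L ⊇ F`** (intended: `L := K = F(E_F[l])` of [IUTchI] Def. 3.1 (c)):
abc-iut-c312-8's `F`-level `pilotDataOfF D` (`j(E_F)`, `𝕍(F)^bad`, `l`) base-changed to `L`.
[cite: Mochizuki2012, IUTchI Def. 3.1 (b),(c) p. 61, Ex. 3.2 (iv) p. 71] [cite: DupuyHilado2025, §3.3] -/
def pilotDataOfK : PilotData L := (pilotDataOfF D).baseChange L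

/-- Its `l` is `D`'s `l`. [cite: Mochizuki2012, IUTchI Def. 3.1 (c) p. 61] -/
@[simp] theorem pilotDataOfK_l : (pilotDataOfK D L).l = l := rfl

/-- Its bad set: the primes of `L` over `𝕍(F)^bad`. [cite: Mochizuki2012, IUTchI Def. 3.1 (b) p. 61] -/
theorem mem_pilotDataOfK_S_iff (w : HeightOneSpectrum (𝓞 L)) :
    w ∈ (pilotDataOfK D L).S ↔ FinitePlace.mk (finBelow F L w) ∈ D.VFbad := by
  unfold pilotDataOfK
  rw [mem_baseChange_S_iff, mem_pilotDataOfF_S_iff]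

/-- Its q-orders: `ord_w(q) = e(w|v)·ord_v(Δ_min)` ([IUTchI] Def. 3.1 (c)'s orders of the q-parameters, times the ramification index).
[cite: Mochizuki2012, IUTchI Def. 3.1 (c) p. 61; IUTchIV Cor. 2.2 (P2) p. 45] -/
theorem ordq_pilotDataOfK {w : HeightOneSpectrum (𝓞 L)} (hw : w ∈ (pilotDataOfK D L).S) :
    (pilotDataOfK D L).ordq w =
      ((finBelow F L w).asIdeal.ramificationIdx' w.asIdeal : ℤ) * (qParamOrd E (finBelow F L w) : ℤ) := by
  unfold pilotDataOfK
  rw [ordq_baseChange]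
  have hv : FinitePlace.mk (finBelow F L w) ∈ D.VFbad := (mem_pilotDataOfK_S_iff D L w).mp hw
  have h := (isPilotDataOf_pilotDataOfF D).ordq_eq (FinitePlace.mk (finBelow F L w)) hv
  rw [FinitePlace.maximalIdeal_mk] at h
  rw [h]

/-- **`|log(q)| = deĝ_L(P_q)` for the `L`-level pilot datum OF `D`** — abc-iut-c312-8's PROVED `absLogq_eq_ndeg_qPilot_pilotDataOfF`
(`|log(q)| := (1/2l)·log(q) = deĝ_F(P_q)`, [IUTchIV] Thm. 1.10 p. 23) transported along `F ⊆ L` by `ndeg_qPilot_baseChange`. PROVED.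
[cite: Mochizuki2012, IUTchIV Thm. 1.10 p. 23] -/
theorem absLogq_eq_ndeg_qPilot_pilotDataOfK : absLogq D = FinDivisor.ndeg L (pilotDataOfK D L).qPilot := by
  unfold pilotDataOfK
  rw [ndeg_qPilot_baseChange, absLogq_eq_ndeg_qPilot_pilotDataOfF]

/-- **`IsPilotDataOfK D L X`** — the `L`-level twin of abc-iut-c312-8's `IsPilotDataOf`: the Dupuy–Hilado pilot datum `X` over `L ⊇ F` is the
one attached to `D` — same `l`; `S` = the primes of `L` over `𝕍(F)^bad`; `ord_w(q) = e(w|v)·ord_v(Δ_min)`. HYPOTHESIS structure,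
inhabited by `pilotDataOfK D L` (`isPilotDataOfK_pilotDataOfK`). [cite: Mochizuki2012, IUTchI Def. 3.1 (b),(c) p. 61] [cite: DupuyHilado2025, §3.3] -/
structure IsPilotDataOfK (X : PilotData L) : Prop where
  /-- same prime `l` -/
  l_eq : X.l = l
  /-- `S` = the primes of `L` over `𝕍(F)^bad` -/
  mem_S_iff : ∀ w : HeightOneSpectrum (𝓞 L), w ∈ X.S ↔ FinitePlace.mk (finBelow F L w) ∈ D.VFbad
  /-- `ord_w(q) = e(w|v)·ord_v(q_v)` -/
  ordq_eq : ∀ w ∈ X.S, X.ordq w = ((finBelow F L w).asIdeal.ramificationIdx' w.asIdeal : ℤ) * (qParamOrd E (finBelow F L w) : ℤ)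

/-- `IsPilotDataOfK` is INHABITED by the base-changed datum. PROVED. [cite: DupuyHilado2025, §3.3] -/
theorem isPilotDataOfK_pilotDataOfK : IsPilotDataOfK D L (pilotDataOfK D L) where
  l_eq := rfl
  mem_S_iff := mem_pilotDataOfK_S_iff D L
  ordq_eq _ hw := ordq_pilotDataOfK D L hw

end Genuine

/-! ## §4. The named divisibility hypothesis and the EXISTENCE of realising ideles under it -/

section Ideles

variable {L : Type} [Field L] [NumberField L] (X : PilotData L)

/-- **`TwoMulLDvdOrdq X` — «`2l ∣ ord_w(q_w)` at every `w ∈ S`»**: the valuation of the `2l`-th root `q̲_w = q_w^{1/2l}` is attained in `L_w`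
([IUTchI] Ex. 3.2 (iv) p. 71, for `L = K`: «`q̲_v :=` a `2l`-th root of the q-parameter», an element of `K_v̲`; it holds there because
`K = F(E_F[l])`, `√−1 ∈ F`, `E_F[2]` rational make `K_v̲/F_v` ramified of index divisible by `2l/gcd(2l, ord_v(q_v)) = 2l` — Tate uniformisation,
classical, NOT re-derived from the typed `InitialThetaData` here). By `Conditional.SideVacuity.two_mul_l_dvd_ordq_of_realising` (p432420) /
abc-iut-c312-3's `exists_realising_qIdeles` (p420764) it is EQUIVALENT to the existence of q-ideles realising `P_q` in the completions of `L`.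
NAMED HYPOTHESIS (C-lead ruling C-R16 (b) «take it as an explicit named hypothesis hK and say so»), never asserted.
[cite: Mochizuki2012, IUTchI Ex. 3.2 (iv) p. 71] -/
def TwoMulLDvdOrdq : Prop := ∀ w ∈ X.S, (2 * (X.l : ℤ)) ∣ X.ordq w

/-- **Realising q-ideles EXIST under `TwoMulLDvdOrdq`**, and they are units off `S` (abc-iut-c312-3's `exists_realising_qIdeles` +
`Cor312PilotIdelesPrWitness.qIdele_norm_eq_one_of_realises`'s content re-derived from `qPilot_apply_of_not_mem`): the side conditions
`htq0`, `htq1`, `htq` of `Real.settingPrVolSharp X …` are JOINTLY SATISFIABLE. [cite: Mochizuki2012, IUTchI Ex. 3.2 (iv) p. 71] [cite: DupuyHilado2025, §3.4] -/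
theorem exists_realising_qIdeles_of_twoMulLDvdOrdq (h : TwoMulLDvdOrdq X) :
    ∃ tq : ∀ (pp : Nat.Primes) (x : (thetaIndex X).Fibre (.inr pp)), haveI : Fact (pp : ℕ).Prime := ⟨pp.2⟩; kOf X pp.1 x,
      (∀ pp x, tq pp x ≠ 0) ∧
      (∀ (pp : Nat.Primes) (x : (thetaIndex X).Fibre (.inr pp)),
          haveI : Fact (pp : ℕ).Prime := ⟨pp.2⟩; placeOf X pp.1 x ∉ X.S → ‖tq pp x‖ = 1) ∧
        ∀ (pp : Nat.Primes) (x : (thetaIndex X).Fibre (.inr pp)),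
          haveI : Fact (pp : ℕ).Prime := ⟨pp.2⟩
          Real.log ‖tq pp x‖ = -(X.qPilot (placeOf X pp.1 x)) * logNorm L (placeOf X pp.1 x) /
            localDegree L (placeOf X pp.1 x) := by
  obtain ⟨tq, htq0, htq⟩ := exists_realising_qIdeles X h
  refine ⟨tq, htq0, fun pp x hx => ?_, htq⟩
  haveI : Fact (pp : ℕ).Prime := ⟨pp.2⟩
  have h1 := htq pp x
  rw [X.qPilot_apply_of_not_mem hx, neg_zero, zero_mul, zero_div] at h1
  -- `log ‖tq‖ = 0` with `tq ≠ 0` forces `‖tq‖ = 1`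
  have hpos : 0 < ‖tq pp x‖ := norm_pos_iff.mpr (htq0 pp x)
  exact Real.eq_one_of_pos_of_log_eq_zero hpos h1

/-- **Realising Θ-ideles EXIST under `TwoMulLDvdOrdq`**, and they are units off `S` (abc-iut-c312-3's `exists_realising_thetaIdeles`;
`P_{Θ,j} = j²·P_q` is supported on `S`): the side conditions `ht0`, `ht1` and the honesty hypothesis `ht` are jointly satisfiable.
[cite: Mochizuki2012, IUTchI Ex. 3.2 (iv) p. 71] [cite: DupuyHilado2025, §3.4] -/
theorem exists_realising_thetaIdeles_of_twoMulLDvdOrdq (h : TwoMulLDvdOrdq X) :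
    ∃ t : ∀ (pp : Nat.Primes) (_ : Fin X.lstar) (x : (thetaIndex X).Fibre (.inr pp)),
        haveI : Fact (pp : ℕ).Prime := ⟨pp.2⟩; kOf X pp.1 x,
      (∀ pp i x, t pp i x ≠ 0) ∧
      (∀ (pp : Nat.Primes) (i : Fin X.lstar) (x : (thetaIndex X).Fibre (.inr pp)),
          haveI : Fact (pp : ℕ).Prime := ⟨pp.2⟩; placeOf X pp.1 x ∉ X.S → ‖t pp i x‖ = 1) ∧
        ∀ (pp : Nat.Primes) (i : Fin X.lstar) (x : (thetaIndex X).Fibre (.inr pp)),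
          haveI : Fact (pp : ℕ).Prime := ⟨pp.2⟩
          Real.log ‖t pp i x‖ = -(X.thetaPilot i (placeOf X pp.1 x)) * logNorm L (placeOf X pp.1 x) /
            localDegree L (placeOf X pp.1 x) := by
  obtain ⟨t, ht0, ht⟩ := exists_realising_thetaIdeles X h
  refine ⟨t, ht0, fun pp i x hx => ?_, ht⟩
  haveI : Fact (pp : ℕ).Prime := ⟨pp.2⟩
  have h1 := ht pp i x
  rw [X.thetaPilot_apply_of_not_mem i hx, neg_zero, zero_mul, zero_div] at h1
  have hpos : 0 < ‖t pp i x‖ := norm_pos_iff.mpr (ht0 pp i x)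
  exact Real.eq_one_of_pos_of_log_eq_zero hpos h1

end Ideles

end Summit.ABC.IUTFork.Cor312Prov

end
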